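import Summits.BirchSwinnertonDyer.Rank1Residual.Partition.CornersLargePrimeSchneider
import Summits.BirchSwinnertonDyer.Rank1Residual.Partition.GreenbergIsogenyPrimesDerived
import HarnessLib

/-!
# Large primes, BOTH axes, rank `≤ 1`, modulo the Schneider certificate — with Greenberg's p. 136
# list (registry A163) replaced by its SOURCES, Mazur 1978 Thm. 1 and the `j`-table
# (cell `b2b-bsdres`, RESIDUAL-MAP.md §A/§C `LARGE PRIMES`; rmap-1 gen 8 over lit-cgls session 11)

HONEST FRAMING (run/shared/lean/b2b/bsd-rank1-residual/, verbatim in every file): the goal of the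
cell is to DELETE the COMBINATION-SHAPED residual classes of the Birch–Swinnerton-Dyer formula for
ALL analytic-rank `≤ 1` elliptic curves over `ℚ` — "full BSD formula for every rank `≤ 1` curve in
class `C`" assembled STRICTLY from published theorems — so that the rank-`≤ 1` remainder becomes
exactly the CONSTRUCTION-SHAPED classes, which are TYPED (missing-input `Prop`s), NOT attempted.
This is not "finishing BSD". Theorems only; NO definition, NO named fact introduced here; every
published theorem enters as one of the tree's existing named Literature facts BY NAME; nothing
about any particular curve is asserted; no label changes; nothing is booked by this file; X11a and
X11b stay CONSTRUCTION-SHAPED (referee A G24), and the certificate clause is, per referee R133.2,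
"COMBINATION, certificate-shaped — covered MODULO per-pair Schneider certificates, NOT
COVERED-from-print" (the binders `hSchN` / `hSchS` below are per-pair OPEN hypotheses).

## What this file records

`Partition/CornersLargePrimeSchneider.lean` (rmap-1 gen 8, p251941) joins the two large-prime
headlines of the block: for EVERY `E/ℚ` of analytic rank `≤ 1` and EVERY prime `p ≥ 11`, `p ≠ 13`,
of good ORDINARY or MULTIPLICATIVE reduction, `BSD(E,p)` holds — modulo the pair's Schneider
certificate when `p` is multiplicative and the rank is one — unless `p` is multiplicative without a
(ram) witness; nineteen named facts, among them registry A163 = Greenberg, LNM 1716 (1999) §5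
p. 136 (`Greenberg1999.p136_mem_isogenyPrimes_of_reducible`, binder `hGr136`: a good-ordinary or
multiplicative Eisenstein prime lies in `{2, 3, 5, 7, 13, 37}`).

lit-cgls SESSION 11 `Partition/GreenbergIsogenyPrimesDerived.lean` (p254078) DERIVES A163 in the
kernel from its printed sources — Mazur, Invent. Math. 44 (1978) Thm. 1
(`mazur_isogeny_irreducible`, binder `hMaz`) and the `j`-table of the rational isogenies of prime
degree `ℓ ∈ {11, 17, 19, 37, 43, 67, 163}` (`primeDegreeIsogeny_jTable`, binder `hT`, already a
binder of the joint headline): `p136_mem_isogenyPrimes_of_reducible_of_mazur : hMaz → hT → A163`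
(via eisenstein-p1's `EisensteinPrimes.mem_of_red_of_good` / `mem_of_red_of_mult`).

This leaf re-spells the four statements of `CornersLargePrimeSchneider.lean` with `hGr136` so
discharged (`…_of_mazur`): the binder list now names Mazur 1978 Thm. 1 instead of Greenberg's
p. 136 remark — still nineteen named facts in the joint form, every one a numbered published
theorem or the `j`-table, the other eighteen unchanged (BCS 2025 Cor. 1.3.1 [flag
`BCS25-IMC-equiv@BSTW`], GZK, BDMTV 2019 Thm. 1.2, the CM rank-`0` BSD-triple fact, Kobayashi 2013
Cor. 1.4, modularity ×2, CGS 2025 Thm. D, GV 2000 Thm. (1.3), Greenberg 1999 Thm. 4.1, the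
`j`-table, Skinner 2016 Thm. C and Thm. A, Stein–Wuthrich 2013 Thm. 6.1 non-split / split, the two
canonical-height existence facts, Disegni 2020 Thm. 1 = A183). Nothing else is claimed; no mark of
RESIDUAL-MAP.md moves; the tier words of R133.2 travel unchanged.

References: `Partition/CornersLargePrimeSchneider.lean` (rmap-1 g8, p251941),
`Partition/GreenbergIsogenyPrimesDerived.lean` (lit-cgls S11, p254078),
`Partition/CornersLargePrimeThirteen.lean` (lit-cgls S9, p250961); RESIDUAL-MAP.md §A, §C;
[Mazur1978] Thm. 1 and table p. 129; [CremonaAlgorithms1997] §3.8 p. 82; [GreenbergLNM1716] §5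
p. 136; [Skinner2016PacificMC] Thm. A, Thm. C; [SteinWuthrich2013] Thm. 6.1, §4.2; [Disegni2020]
Thm. 1; [BurungaleCastellaSkinner2025] Cor. 1.3.1; [CastellaGrossiSkinner2025] Thm. D.
-/

namespace Summit.BirchSwinnertonDyer.Rank1Residual

open WeierstrassCurve Literature.NumberTheory.EllipticCurves
  Literature.NumberTheory.EllipticCurves.Rank1Residual Literature.NumberTheory.EllipticCurves.ModularForms
  Literature.NumberTheory.EllipticCurves.Greenberg1999
  Literature.NumberTheory.EllipticCurves.Rank1Residual.Typed
  Literature.NumberTheory.EllipticCurves.Skinner2016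
  Literature.NumberTheory.EllipticCurves.SteinWuthrich2013
  Literature.NumberTheory.EllipticCurves.Disegni2020
open scoped NumberField ModularForm

section Curve

variable {W : WeierstrassCurve ℚ} [W.IsElliptic] [W.IsGloballyMinimal] {p : ℕ} [Fact p.Prime]

/-- **Multiplicative `p ≥ 11`, `p ≠ 13`, analytic rank `≤ 1`, a (ram) witness ⇒ `BSD(E,p)`, the
Schneider certificate required ONLY in rank one — A163 discharged by Mazur 1978 Thm. 1 + the
`j`-table:** `bsdp_mult_of_eleven_le_of_ne_thirteen_of_ram_of_schneider` with
`hGr136 := p136_mem_isogenyPrimes_of_reducible_of_mazur hMaz hT`. Tier (referee R133.2):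
certificate-shaped, NOT covered-from-print. [cite: Skinner2016PacificMC, Thm. A and Thm. C]
[cite: SteinWuthrich2013, Thm. 6.1 and §4.2] [cite: Disegni2020, Thm. 1]
[cite: Mazur1978, Thm. 1 and table p. 129] [cite: CremonaAlgorithms1997, §3.8 p. 82] -/
theorem bsdp_mult_of_eleven_le_of_ne_thirteen_of_ram_of_schneider_of_mazur
    (hSk : Skinner2016.thmC_padicValRat_bsd_rank_zero)
    (hmod : hasEntireLFunction_rat) (hGZK : rank_eq_analyticRank_of_analyticRank_le_one)
    (hmodP : nonempty_modularParametrizationData)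
    (hMaz : mazur_isogeny_irreducible) (hT : primeDegreeIsogeny_jTable)
    (hA : thmA_charIdeal_multiplicative)
    (hJn : thm61_nonsplitMultiplicative) (hJs : thm61_splitMultiplicative)
    (hHn : exists_isMultCanonical) (hHs : exists_isSplitMultCanonical)
    (hD : thm1_padicBSD_rankOne_multiplicative)
    (hm : Mult W p) (hr : W.analyticRank ≤ 1) (h11 : 11 ≤ p) (h13 : p ≠ 13) (hram : Ram W p)
    (hSchN : W.analyticRank = 1 → ∀ (q : ℚ_[p]) (Dh : PAdicHeightData W p), q ≠ 0 → ‖q‖ < 1 →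
      tateJ q = (W.j : ℚ_[p]) → IsMultCanonical Dh q → SchneiderConjecture Dh)
    (hSchS : W.analyticRank = 1 → ∀ (Dq : TateParameterData W p) (Dh : PAdicHeightData W p),
      IsSplitMultCanonical Dh Dq → SchneiderConjecture Dh) : BSDp W p :=
  bsdp_mult_of_eleven_le_of_ne_thirteen_of_ram_of_schneider hSk hmod hGZK hmodP
    (p136_mem_isogenyPrimes_of_reducible_of_mazur hMaz hT) hT hA hJn hJs hHn hHs hD hm hr h11 h13
    hram hSchN hSchS

/-- **The corner in the block's class vocabulary, A163 discharged:** at `p ≥ 11`, `p ≠ 13`, in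
analytic rank `≤ 1`, 'multiplicative without a (ram) witness' is exactly `X11a ∨ (X11b ∧ ¬Ram)` —
irreducibility of `E[p]` at a multiplicative `p ≥ 11`, `p ≠ 13` from Mazur 1978 Thm. 1 + the
`j`-table (`EisensteinPrimes.mem_of_red_of_mult` even excludes `37`).
[cite: Mazur1978, Thm. 1 and table p. 129] [cite: CremonaAlgorithms1997, §3.8 p. 82] -/
theorem corner_iff_of_mult_of_eleven_le_of_ne_thirteen_of_mazur
    (hMaz : mazur_isogeny_irreducible) (hT : primeDegreeIsogeny_jTable)
    (hr : W.analyticRank ≤ 1) (h11 : 11 ≤ p) (h13 : p ≠ 13) :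
    (Mult W p ∧ ¬ Ram W p) ↔ (ClassX11a W p ∨ (ClassX11b W p ∧ ¬ Ram W p)) :=
  corner_iff_of_mult_of_eleven_le_of_ne_thirteen
    (p136_mem_isogenyPrimes_of_reducible_of_mazur hMaz hT) hT hr h11 h13

/-! ### Both axes at `p ≥ 11`, `p ≠ 13` -/

/-- **LARGE PRIMES, BOTH AXES, rank `≤ 1`, modulo the certificate — every binder a numbered
published theorem or the `j`-table.** For EVERY `E/ℚ` (CM included) of analytic rank `≤ 1` and
EVERY prime `p ≥ 11` with `p ≠ 13` at which `E` has good ORDINARY or MULTIPLICATIVE reduction,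
`BSD(E,p)` holds — granted, when `p` is multiplicative and the rank is one, the pair's Schneider
certificate — unless `p` is multiplicative and there is no (ram) witness. This is
`bsdp_goodOrd_or_mult_of_eleven_le_of_ne_thirteen_of_schneider` with Greenberg's p. 136 list
(A163) discharged by Mazur 1978 Thm. 1 (`hMaz`) and the `j`-table (`hT`):
`hGr136 := p136_mem_isogenyPrimes_of_reducible_of_mazur hMaz hT`. Nineteen named facts. Tier of
the certificate clause (referee R133.2): certificate-shaped, NOT covered-from-print; nothing booked.
[cite: BurungaleCastellaSkinner2025, Cor. 1.3.1] [cite: CastellaGrossiSkinner2025, Theorem D]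
[cite: Skinner2016PacificMC, Thm. A and Thm. C] [cite: SteinWuthrich2013, Thm. 6.1 and §4.2]
[cite: Disegni2020, Thm. 1] [cite: GreenbergLNM1716, Thm. 4.1]
[cite: Mazur1978, Thm. 1 and table p. 129] [cite: CremonaAlgorithms1997, §3.8 p. 82] -/
theorem bsdp_goodOrd_or_mult_of_eleven_le_of_ne_thirteen_of_schneider_of_mazur
    (hBCS : BurungaleCastellaSkinner2025.cor131_padicValRat_bsd_rank_le_one)
    (hGZK : rank_eq_analyticRank_of_analyticRank_le_one)
    (hBDMTV : BalakrishnanEtAl2019.thm12_not_le_normalizer_splitCartan)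
    (hCM : bsdTriple_of_hasCM_of_L_one_ne_zero) (hKob : Kobayashi2013.cor14_bsdp_of_cm_rank_one)
    (hmod : hasEntireLFunction_rat) (hmodP : nonempty_modularParametrizationData)
    (hCGS : CastellaGrossiSkinner2025.thmD_padicValRat_bsd_rank_le_one)
    (hGV : GreenbergVatsal2000.thm13_charIdeal_eq_of_gvPar) (hGr : greenberg_charValue_rankZero)
    (hMaz : mazur_isogeny_irreducible) (hT : primeDegreeIsogeny_jTable)
    (hSk : Skinner2016.thmC_padicValRat_bsd_rank_zero) (hA : thmA_charIdeal_multiplicative)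
    (hJn : thm61_nonsplitMultiplicative) (hJs : thm61_splitMultiplicative)
    (hHn : exists_isMultCanonical) (hHs : exists_isSplitMultCanonical)
    (hD : thm1_padicBSD_rankOne_multiplicative)
    (hr : W.analyticRank ≤ 1) (hred : GoodOrd W p ∨ Mult W p) (h11 : 11 ≤ p) (h13 : p ≠ 13)
    (hram : Mult W p → Ram W p)
    (hSchN : Mult W p → W.analyticRank = 1 → ∀ (q : ℚ_[p]) (Dh : PAdicHeightData W p), q ≠ 0 →
      ‖q‖ < 1 → tateJ q = (W.j : ℚ_[p]) → IsMultCanonical Dh q → SchneiderConjecture Dh)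
    (hSchS : Mult W p → W.analyticRank = 1 → ∀ (Dq : TateParameterData W p)
      (Dh : PAdicHeightData W p), IsSplitMultCanonical Dh Dq → SchneiderConjecture Dh) :
    BSDp W p :=
  bsdp_goodOrd_or_mult_of_eleven_le_of_ne_thirteen_of_schneider hBCS hGZK hBDMTV hCM hKob hmod
    hmodP hCGS hGV hGr (p136_mem_isogenyPrimes_of_reducible_of_mazur hMaz hT) hT hSk hA hJn hJs hHn
    hHs hD hr hred h11 h13 hram hSchN hSchS

/-- **Partition form at `p ≥ 11`, `p ≠ 13`, both axes, rank `≤ 1`, A163 discharged:** `BSD(E,p)`,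
or the pair is 'multiplicative without a (ram) witness' (= X11a ∨ (X11b ∧ ¬Ram),
`corner_iff_of_mult_of_eleven_le_of_ne_thirteen_of_mazur`) — modulo the certificate on the
multiplicative rank-one pairs. [cite: BurungaleCastellaSkinner2025, Cor. 1.3.1]
[cite: Skinner2016PacificMC, Thm. A and Thm. C] [cite: Disegni2020, Thm. 1]
[cite: Mazur1978, Thm. 1 and table p. 129] -/
theorem bsdp_or_corner_of_eleven_le_of_ne_thirteen_of_schneider_of_mazur
    (hBCS : BurungaleCastellaSkinner2025.cor131_padicValRat_bsd_rank_le_one)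
    (hGZK : rank_eq_analyticRank_of_analyticRank_le_one)
    (hBDMTV : BalakrishnanEtAl2019.thm12_not_le_normalizer_splitCartan)
    (hCM : bsdTriple_of_hasCM_of_L_one_ne_zero) (hKob : Kobayashi2013.cor14_bsdp_of_cm_rank_one)
    (hmod : hasEntireLFunction_rat) (hmodP : nonempty_modularParametrizationData)
    (hCGS : CastellaGrossiSkinner2025.thmD_padicValRat_bsd_rank_le_one)
    (hGV : GreenbergVatsal2000.thm13_charIdeal_eq_of_gvPar) (hGr : greenberg_charValue_rankZero)
    (hMaz : mazur_isogeny_irreducible) (hT : primeDegreeIsogeny_jTable)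
    (hSk : Skinner2016.thmC_padicValRat_bsd_rank_zero) (hA : thmA_charIdeal_multiplicative)
    (hJn : thm61_nonsplitMultiplicative) (hJs : thm61_splitMultiplicative)
    (hHn : exists_isMultCanonical) (hHs : exists_isSplitMultCanonical)
    (hD : thm1_padicBSD_rankOne_multiplicative)
    (hr : W.analyticRank ≤ 1) (hred : GoodOrd W p ∨ Mult W p) (h11 : 11 ≤ p) (h13 : p ≠ 13)
    (hSchN : Mult W p → W.analyticRank = 1 → ∀ (q : ℚ_[p]) (Dh : PAdicHeightData W p), q ≠ 0 →
      ‖q‖ < 1 → tateJ q = (W.j : ℚ_[p]) → IsMultCanonical Dh q → SchneiderConjecture Dh)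
    (hSchS : Mult W p → W.analyticRank = 1 → ∀ (Dq : TateParameterData W p)
      (Dh : PAdicHeightData W p), IsSplitMultCanonical Dh Dq → SchneiderConjecture Dh) :
    BSDp W p ∨ (Mult W p ∧ ¬ Ram W p) :=
  bsdp_or_corner_of_eleven_le_of_ne_thirteen_of_schneider hBCS hGZK hBDMTV hCM hKob hmod hmodP hCGS
    hGV hGr (p136_mem_isogenyPrimes_of_reducible_of_mazur hMaz hT) hT hSk hA hJn hJs hHn hHs hD hr
    hred h11 h13 hSchN hSchS

end Curve

end Summit.BirchSwinnertonDyer.Rank1Residual
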